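import Summits.QuantumFields.YangMills.Theorems.SwapVirialDeficitZeroModeGroupThreeSmallBallLimit
import HarnessLib

/-!
# Exact zero-mode rung Z4 in SMALL-BALL form — VI: thin quadratic layers (toward the POWER-RATE remainder `O(t^θ)`)
# (LEAD ym-line-sfw-p2 g93 07:46Z «`Haar³{N₃(t)} = v₃t⁴(1 + O(t^θ))`»; free-hands support of ⟨stmt-QuantumFields-24197⟩)

The rate `|Haar³(N₃(t))/t⁴ − v₃′| ≤ K·t^θ` is the measure of the symmetric difference `G_s(a) Δ G₀(a)` of the rescaled events
(parts I–IV), integrated over the hub.  Each of the five defining inequalities of `G_s(a)` is affine in `s` and QUADRATIC IN ONE COORDINATE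
(`x₀` or `y₀`), so a flip between `s` and `0` puts that coordinate in a thin layer `{c ≤ x₀² ≤ c + ε}` of length `≤ 2√ε`.  This file:
* §12 ★ `volume_sq_layer_le` — `vol{r ∈ ℝ | c ≤ r² ≤ c + ε} ≤ 2√ε`;
* §13 ★ `volume_coordLayer_le` — in the pair coordinates `((x₀,y₀),rest)` of ✓`ZeroModeGroup.pairCoord` (w2 g55), a measurable set whose
  `x₀`-sections are such layers, of widths `ε(y₀,rest)` on a window `W`, has volume `≤ ∫_W 2√ε`; `volume_coordLayer_le'` the same for `y₀`.
Part VII: the five flips and the per-hub bound `(vol⊗vol)(G_s(a) Δ G₀(a)) ≤ C·√s/r⁶`; part VIII: hub integrals and the rate.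
HONEST LABEL: finite-dimensional measure theory (plan-level zero-mode rung of a DRAFT line); NOT ⟨24197⟩; the Yang–Mills mass gap is NOT proved; no summit
is proved by a line.  Seat ym-line-fcl-p3 g44, `--supports stmt-QuantumFields-24197`.  THEOREMS ONLY, standard axioms.  References: [cite: GonzalezarroyoAltes1988];
[cite: Vanbaal2001]; [folklore].
-/

set_option autoImplicit false

noncomputable section

open MeasureTheory Quaternion Set Filter Topology
open scoped Quaternion ENNReal BigOperators Topology
open Literature.MathematicalPhysics.QuantumLattice
open Summit.QuantumFields.YangMills.Theorems.SwapTwistDeficit.ToronLog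

attribute [local instance] Literature.Analysis.FluidPDE.Tao2016.quatMeasurableSpace
  Literature.Analysis.FluidPDE.Tao2016.quatBorelSpace
  Literature.MathematicalPhysics.QuantumLattice.secondCountableTopology_su2

namespace Summit.QuantumFields.YangMills.Theorems.SwapVirialDeficit.ZeroModeGroup

/-! ## §12 Thin quadratic layers on the line -/

/-- `√(c + ε) ≤ √(max c 0) + √ε` for `ε ≥ 0`. [folklore] -/
theorem sqrt_add_le_sqrt_max_add {c ε : ℝ} (hε : 0 ≤ ε) : Real.sqrt (c + ε) ≤ Real.sqrt (max c 0) + Real.sqrt ε := by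
  have h0 : 0 ≤ Real.sqrt (max c 0) + Real.sqrt ε := by positivity
  rw [show Real.sqrt (max c 0) + Real.sqrt ε = Real.sqrt ((Real.sqrt (max c 0) + Real.sqrt ε) ^ 2) from (Real.sqrt_sq h0).symm]
  refine Real.sqrt_le_sqrt ?_
  have h1 : (Real.sqrt (max c 0)) ^ 2 = max c 0 := Real.sq_sqrt (le_max_right _ _)
  have h2 : (Real.sqrt ε) ^ 2 = ε := Real.sq_sqrt hε
  nlinarith [le_max_left c 0, Real.sqrt_nonneg (max c 0), Real.sqrt_nonneg ε]

/-- The quadratic layer lies in two intervals of length `√(c+ε) − √(max c 0)`. [folklore] -/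
theorem sq_layer_subset (c ε : ℝ) :
    {r : ℝ | c ≤ r ^ 2 ∧ r ^ 2 ≤ c + ε} ⊆
      Set.Icc (Real.sqrt (max c 0)) (Real.sqrt (c + ε)) ∪ Set.Icc (-Real.sqrt (c + ε)) (-Real.sqrt (max c 0)) := by
  intro r hr
  obtain ⟨h1, h2⟩ := hr
  have hup : |r| ≤ Real.sqrt (c + ε) := Real.abs_le_sqrt h2
  have hlo : Real.sqrt (max c 0) ≤ |r| := by
    rw [← Real.sqrt_sq_eq_abs]
    exact Real.sqrt_le_sqrt (max_le h1 (sq_nonneg r))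
  rcases le_or_gt 0 r with hr0 | hr0
  · rw [abs_of_nonneg hr0] at hup hlo
    exact Or.inl ⟨hlo, hup⟩
  · rw [abs_of_neg hr0] at hup hlo
    exact Or.inr ⟨by linarith, by linarith⟩

/-- ★ **Thin quadratic layer**: `vol{r ∈ ℝ | c ≤ r² ≤ c + ε} ≤ 2√ε` (`ε ≥ 0`, any `c`). [folklore] -/
theorem volume_sq_layer_le (c : ℝ) {ε : ℝ} (hε : 0 ≤ ε) :
    (volume : Measure ℝ) {r : ℝ | c ≤ r ^ 2 ∧ r ^ 2 ≤ c + ε} ≤ ENNReal.ofReal (2 * Real.sqrt ε) := by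
  have hlen : Real.sqrt (c + ε) - Real.sqrt (max c 0) ≤ Real.sqrt ε := by linarith [sqrt_add_le_sqrt_max_add (c := c) hε]
  calc (volume : Measure ℝ) {r : ℝ | c ≤ r ^ 2 ∧ r ^ 2 ≤ c + ε}
      ≤ volume (Set.Icc (Real.sqrt (max c 0)) (Real.sqrt (c + ε)) ∪ Set.Icc (-Real.sqrt (c + ε)) (-Real.sqrt (max c 0))) :=
        measure_mono (sq_layer_subset c ε)
    _ ≤ volume (Set.Icc (Real.sqrt (max c 0)) (Real.sqrt (c + ε))) + volume (Set.Icc (-Real.sqrt (c + ε)) (-Real.sqrt (max c 0))) :=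
        measure_union_le _ _
    _ = ENNReal.ofReal (Real.sqrt (c + ε) - Real.sqrt (max c 0)) + ENNReal.ofReal (Real.sqrt (c + ε) - Real.sqrt (max c 0)) := by
        rw [Real.volume_Icc, Real.volume_Icc]; congr 2; ring
    _ ≤ ENNReal.ofReal (Real.sqrt ε) + ENNReal.ofReal (Real.sqrt ε) := add_le_add (ENNReal.ofReal_le_ofReal hlen) (ENNReal.ofReal_le_ofReal hlen)
    _ = ENNReal.ofReal (2 * Real.sqrt ε) := by rw [← ENNReal.ofReal_add (Real.sqrt_nonneg _) (Real.sqrt_nonneg _)]; ring_nf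

/-! ## §13 Layers in the pair coordinates `((x₀, y₀), rest)` -/

/-- ★ **Layer lemma, first coordinate.**  On a product `(ℝ × ℝ) × R`, let `T` be measurable and suppose every point `((x₀,y₀),w) ∈ T` has
`(y₀, w) ∈ W` and `g(y₀,w) ≤ x₀² ≤ g(y₀,w) + e(y₀,w)` with `e ≥ 0`.  Then `vol(T) ≤ ∫_{(y₀,w)} 𝟙_W·2√e`. [folklore] -/
theorem volume_coordLayer_le {R : Type*} [MeasureSpace R] [SFinite (volume : Measure R)]
    {T : Set ((ℝ × ℝ) × R)} (hT : MeasurableSet T) {W : Set (ℝ × R)} (g e : ℝ × R → ℝ) (he : ∀ q, 0 ≤ e q)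
    (hmem : ∀ (x₀ y₀ : ℝ) (w : R), ((x₀, y₀), w) ∈ T → (y₀, w) ∈ W ∧ g (y₀, w) ≤ x₀ ^ 2 ∧ x₀ ^ 2 ≤ g (y₀, w) + e (y₀, w)) :
    (volume : Measure ((ℝ × ℝ) × R)) T ≤
      ∫⁻ w, ∫⁻ y₀, W.indicator (fun q => ENNReal.ofReal (2 * Real.sqrt (e q))) (y₀, w) ∂(volume : Measure ℝ) ∂(volume : Measure R) := by
  -- sections over `R`, then over `y₀`
  rw [show (volume : Measure ((ℝ × ℝ) × R)) = ((volume : Measure (ℝ × ℝ)).prod (volume : Measure R)) from rfl, Measure.prod_apply_symm hT]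
  refine lintegral_mono fun w => ?_
  have hTw : MeasurableSet ((fun p : ℝ × ℝ => (p, w)) ⁻¹' T) := hT.preimage (measurable_id.prodMk measurable_const)
  rw [show (volume : Measure (ℝ × ℝ)) = ((volume : Measure ℝ).prod (volume : Measure ℝ)) from rfl, Measure.prod_apply_symm hTw]
  refine lintegral_mono fun y₀ => ?_
  -- the `x₀`-section is a quadratic layer (or empty)
  by_cases hW : (y₀, w) ∈ W
  · rw [Set.indicator_of_mem hW]
    refine le_trans (measure_mono fun x₀ hx => ?_) (volume_sq_layer_le (g (y₀, w)) (he (y₀, w)))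
    exact (hmem x₀ y₀ w hx).2
  · rw [Set.indicator_of_notMem hW]
    have he0 : (fun x₀ : ℝ => (x₀, y₀)) ⁻¹' ((fun p : ℝ × ℝ => (p, w)) ⁻¹' T) = ∅ := by
      ext x₀
      simp only [Set.mem_preimage, Set.mem_empty_iff_false, iff_false]
      exact fun hx => hW (hmem x₀ y₀ w hx).1
    rw [he0, measure_empty]

/-- The same with the iterated bound written as a single integral over `ℝ × R`. [folklore] -/
theorem volume_coordLayer_le_lintegral {R : Type*} [MeasureSpace R] [SFinite (volume : Measure R)]
    {T : Set ((ℝ × ℝ) × R)} (hT : MeasurableSet T) {W : Set (ℝ × R)} (g e : ℝ × R → ℝ) (he : ∀ q, 0 ≤ e q)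
    (hmem : ∀ (x₀ y₀ : ℝ) (w : R), ((x₀, y₀), w) ∈ T → (y₀, w) ∈ W ∧ g (y₀, w) ≤ x₀ ^ 2 ∧ x₀ ^ 2 ≤ g (y₀, w) + e (y₀, w))
    (hF : Measurable fun q : ℝ × R => W.indicator (fun q => ENNReal.ofReal (2 * Real.sqrt (e q))) q) :
    (volume : Measure ((ℝ × ℝ) × R)) T ≤
      ∫⁻ q, W.indicator (fun q => ENNReal.ofReal (2 * Real.sqrt (e q))) q ∂((volume : Measure ℝ).prod (volume : Measure R)) := by
  rw [lintegral_prod_symm _ hF.aemeasurable]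
  exact volume_coordLayer_le hT g e he hmem

/-- Swapping the two coordinates of the first factor preserves the product volume. [folklore] -/
theorem measurePreserving_swap_fst {R : Type*} [MeasureSpace R] [SFinite (volume : Measure R)] :
    MeasurePreserving (fun p : (ℝ × ℝ) × R => ((p.1.2, p.1.1), p.2)) (volume : Measure ((ℝ × ℝ) × R)) (volume : Measure ((ℝ × ℝ) × R)) := by
  have h1 : MeasurePreserving (Prod.swap : ℝ × ℝ → ℝ × ℝ) (volume : Measure (ℝ × ℝ)) (volume : Measure (ℝ × ℝ)) :=
    Measure.measurePreserving_swap
  have h := h1.prod (MeasurePreserving.id (volume : Measure R))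
  exact h

/-- ★ **Layer lemma, second coordinate** (`y₀`-layers): the same with the roles of `x₀` and `y₀` exchanged. [folklore] -/
theorem volume_coordLayer_le' {R : Type*} [MeasureSpace R] [SFinite (volume : Measure R)]
    {T : Set ((ℝ × ℝ) × R)} (hT : MeasurableSet T) {W : Set (ℝ × R)} (g e : ℝ × R → ℝ) (he : ∀ q, 0 ≤ e q)
    (hmem : ∀ (x₀ y₀ : ℝ) (w : R), ((x₀, y₀), w) ∈ T → (x₀, w) ∈ W ∧ g (x₀, w) ≤ y₀ ^ 2 ∧ y₀ ^ 2 ≤ g (x₀, w) + e (x₀, w))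
    (hF : Measurable fun q : ℝ × R => W.indicator (fun q => ENNReal.ofReal (2 * Real.sqrt (e q))) q) :
    (volume : Measure ((ℝ × ℝ) × R)) T ≤
      ∫⁻ q, W.indicator (fun q => ENNReal.ofReal (2 * Real.sqrt (e q))) q ∂((volume : Measure ℝ).prod (volume : Measure R)) := by
  -- transport by the swap of the first factor
  set T' : Set ((ℝ × ℝ) × R) := (fun p : (ℝ × ℝ) × R => ((p.1.2, p.1.1), p.2)) ⁻¹' T with hT'
  have hmeas : Measurable fun p : (ℝ × ℝ) × R => ((p.1.2, p.1.1), p.2) :=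
    ((measurable_snd.comp measurable_fst).prodMk (measurable_fst.comp measurable_fst)).prodMk measurable_snd
  have hT'm : MeasurableSet T' := hT.preimage hmeas
  have hvol : (volume : Measure ((ℝ × ℝ) × R)) T = (volume : Measure ((ℝ × ℝ) × R)) T' := by
    rw [hT']
    have e : T = (fun p : (ℝ × ℝ) × R => ((p.1.2, p.1.1), p.2)) ⁻¹' T' := by
      ext p; simp [hT']
    conv_lhs => rw [e]
    exact (measurePreserving_swap_fst.measure_preimage hT'm.nullMeasurableSet)
  rw [hvol]
  refine volume_coordLayer_le_lintegral hT'm g e he (fun x₀ y₀ w hx => ?_) hF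
  simp only [hT', Set.mem_preimage] at hx
  exact hmem y₀ x₀ w hx

end Summit.QuantumFields.YangMills.Theorems.SwapVirialDeficit.ZeroModeGroup

end
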